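import Literature.NumberTheory.GaloisRepresentations.WeilLAdicCharacterDeRham
import HarnessLib

/-!
# A de Rham `ℓ`-adic character of a number field comes from an algebraic Hecke character
# (Serre 1968 Ch. III with Tate; Patrikis 2019, Prop. 2.2.1 — named fact)

Topic `NumberTheory/GaloisRepresentations`; namespace `Literature.NumberTheory.GaloisRepresentations`.
CONVERSE companion of the named fact `HeckeCharacter.exists_lAdic_isDeRhamFramed`
(`WeilLAdicCharacterDeRham`: the `ℓ`-adic character of an algebraic Hecke character is de Rham above
`ℓ`) and the global form of the PROVED `exists_heckeCharacter_of_idelic_locallyAlgebraic`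
(`LocallyAlgebraicHeckeCharacterProofs`: an idelically locally algebraic `ℓ`-adic character comes from an
algebraic Hecke character).  Together the two facts are the Fontaine–Mazur–Langlands dictionary for
`GL₁` over a number field `K` (a THEOREM in rank one, Patrikis loc. cit.):

> S. Patrikis, *Variations on a theorem of Tate*, Mem. AMS 258 (2019) no. 1238 = arXiv:1207.6724,
> Ch. 2 §2.2 "Galois `GL₁`", **Proposition 2.2.1** (numbering of the arXiv text): "Suppose that `ψ̂`
> is de Rham. Then for all places `v` not dividing `ℓ`, `ψ̂|_{Γ_{F_v}}` assumes algebraic values in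
> `ℚ̄ ↪ ℚ̄_ℓ`, and there exists a type `A₀` (i.e. `L = C`-algebraic) Hecke character
> `ψ : 𝔸_F^×/F^× → ℂ^×` corresponding to `ψ̂` (via `ι_∞ : ℚ̄ ↪ ℂ`). Moreover, `ψ̂` is motivic […]."
> ("The following is well-known, a combination of work of Serre, Henniart, and Waldschmidt" —
> a theorem, quoted with its proof sketch there.)

The classical proof: a de Rham (equivalently Hodge–Tate) `ℓ`-adic CHARACTER of a local field is
locally algebraic (Tate; Serre, *Abelian ℓ-adic representations* (1968), Ch. III App. A, A.6–A.7 with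
§1.2; for characters de Rham ⟺ Hodge–Tate ⟺ `ψ̂ ∘ Art = ∏_τ τ^{-n_τ}` near `1`, B. Conrad, *Lifting
global representations with local properties* (2011), App. B Prop. B.4), and a locally algebraic
abelian `ℓ`-adic representation of `K` comes from an algebraic Hecke character (Serre Ch. III §2.3
Thm. 2 with Ch. II §2.7; proved in the tree in idelic form, `exists_heckeCharacter_of_idelic_locallyAlgebraic`).

## Rendering (read before reviewing)

* "`ψ̂` de Rham": de Rham at EVERY place `v ∣ ℓ` for Fontaine's PINNED datum of the summit,
  `(PAdicHodge.fontainePstAdicCompletion v ℓ hv).IsDeRhamFramed (ψ̂.toLocal v)` — the clause of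
  `HeckeCharacter.exists_lAdic_isDeRhamFramed` (ii) and of the `GL₂` facts `Tung2021_fontaineMazurGL2`,
  `XZhang2024_fontaineMazurGL2_oddPrime` (rank one has a single labelled weight per label, so no
  regularity clause).  Continuity of `ψ̂` is built into `FramedGaloisRep`; a continuous `ℓ`-adic
  character is automatically unramified at all but finitely many places, which the conclusion restates.
* "corresponding to `ψ̂` via `ι_∞`": for a field isomorphism `ι : ℚ̄_ℓ ≃+* ℂ` (which restricts on `ℚ̄`
  to a pair `(ι_ℓ, ι_∞)` as in Patrikis's Notation), the Frobenius–uniformiser dictionary at all but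
  finitely many finite places in the tree's normalisation (arithmetic Frobenius,
  `ψ̂(Frob_v) = ι⁻¹(χ(ϖ_v))⁻¹`, i.e. `ψ̂.HasFrobCharpolyAt v (X - C (ι⁻¹(χ(ϖ_v))⁻¹))`
  `= arithFrobPolyOfSatake ι q_v 1 {χ(ϖ_v)}`) — VERBATIM the conclusion of the accepted
  `exists_heckeCharacter_of_weaklyDivides` (Böckle–Hui) and of the proved
  `exists_heckeCharacter_of_idelic_locallyAlgebraic`, and inverse to clause (i) of
  `HeckeCharacter.exists_lAdic_isDeRhamFramed`.  "type `A₀`" = `HeckeCharacter.IsAlgebraic`.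
* NOT vendored (weaker statement, same cite): the algebraicity of the local values at `v ∤ ℓ`, the
  "motivic" clause, and the dictionary "infinity type of `χ` ↔ labelled Hodge–Tate weights of `ψ̂`"
  (Serre Ch. III §1.1–1.2).
  -- TODO(general form): add the clause `HT_τ(ψ̂) = {-n_τ}` ↔ `χ` of infinity type `(n_τ)` once labelled weights of rank-one framed representations are pinned (cf. clause (F11) of `FontaineDpst`).
* Consumers: crux `DyadicOddResidue.DyadicEisensteinFM` (stmt-Langlands-18741), stub `stub_inducedCase`
  (CM leg of Fontaine–Mazur for `GL₂/ℚ` at `ℓ = 2`: the Clifford character of a quadratically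
  imprimitive de Rham `ρ` is a Hecke character; helper `Theorems/DyadicOddResidueDyadicEisensteinFMStubInducedCase`),
  and any "de Rham ⟹ automorphic" statement in rank one.
* `lean search 'exists_heckeCharacter_of_isDeRham|fontaineMazurGLOne|heckeCharacter_of_deRham'`
  (2026-08-17): no prior declaration.

## References

* S. Patrikis, *Variations on a theorem of Tate*, Mem. Amer. Math. Soc. 258 (2019), no. 1238
  (arXiv:1207.6724), Ch. 2 §2.2, Prop. 2.2.1. [Patrikis2019]
* J.-P. Serre, *Abelian ℓ-adic representations and elliptic curves* (1968), Ch. II §2.7, Ch. III §1.1–1.2,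
  §2.3 (Theorem 2), App. A (A.6–A.7). [SerreAbelianLadic1968]
* B. Conrad, *Lifting global representations with local properties* (2011), App. B, Prop. B.4.
  [Conrad2011LiftingGlobal]
-/

noncomputable section

open scoped NumberField Polynomial
open NumberField IsDedekindDomain Field Polynomial Filter

namespace Literature.NumberTheory.GaloisRepresentations

/-- **A de Rham `ℓ`-adic character of a number field is the `ℓ`-adic avatar of an algebraic Hecke
character** (Patrikis 2019, Prop. 2.2.1: "Suppose that `ψ̂` is de Rham. Then … there exists a type `A₀`
Hecke character `ψ` corresponding to `ψ̂` (via `ι_∞`). Moreover, `ψ̂` is motivic […]"; Serre 1968, Ch. III §2.3 Thm. 2 with App. A (Tate): de Rham ⟹ locally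
algebraic ⟹ Hecke).  Vendored: for every number field `K`, prime `ℓ`, continuous character
`ψ̂ : Γ_K → GL₁(ℚ̄_ℓ)` which is de Rham at every `v ∣ ℓ` for Fontaine's pinned datum
(`(fontainePstAdicCompletion v ℓ hv).IsDeRhamFramed (ψ̂.toLocal v)`), and every field isomorphism
`ι : ℚ̄_ℓ ≃+* ℂ`, there is an ALGEBRAIC Hecke character `χ` of `K` (`HeckeCharacter.IsAlgebraic`, type
`A₀`) such that at all but finitely many finite places `v`, `χ` and `ψ̂` are unramified and
`ψ̂(Frob_v) = ι⁻¹(χ(ϖ_v))⁻¹` (arithmetic Frobenius; `ψ̂.HasFrobCharpolyAt v (X - C (ι⁻¹(χ(ϖ_v))⁻¹))`) —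
the conclusion shape of `exists_heckeCharacter_of_weaklyDivides`.  Named fact (D-0014), not proved here
(the tree lacks "de Rham character ⟹ idelically locally algebraic"; the step "locally algebraic ⟹ Hecke"
is the proved `exists_heckeCharacter_of_idelic_locallyAlgebraic`).
-- TODO(general form): the infinity type of `χ` is read off the labelled Hodge–Tate weights of `ψ̂` (Serre Ch. III §1.1); local values at `v ∤ ℓ` are algebraic.
[cite: Patrikis2019, Prop. 2.2.1 (Ch. 2 §2.2, numbering of arXiv:1207.6724)]
[cite: SerreAbelianLadic1968, Ch. III §2.3 Thm. 2 and App. A (A.6–A.7)]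
[cite: Conrad2011LiftingGlobal, App. B, Prop. B.4] -/
def FramedGaloisRep.exists_heckeCharacter_of_isDeRhamFramed : Prop :=
  ∀ (K : Type) [Field K] [NumberField K] (ℓ : ℕ) [Fact ℓ.Prime]
    (ψ : FramedGaloisRep K (PadicAlgCl ℓ) 1),
    (∀ (v : HeightOneSpectrum (𝓞 K)) (hv : ((ℓ : ℕ) : 𝓞 K) ∈ v.asIdeal),
      (PAdicHodge.fontainePstAdicCompletion v ℓ hv).IsDeRhamFramed (ψ.toLocal v)) →
    ∀ (ι : PadicAlgCl ℓ ≃+* ℂ), ∃ χ : HeckeCharacter K, χ.IsAlgebraic ∧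
      ∀ᶠ v : HeightOneSpectrum (𝓞 K) in cofinite, χ.IsUnramifiedAt v ∧ ψ.IsUnramifiedAt v ∧
        ψ.HasFrobCharpolyAt v (X - C (ι.symm (χ.valueAtUniformizer v)⁻¹))

/-- Unfolding lemma for `FramedGaloisRep.exists_heckeCharacter_of_isDeRhamFramed`. [folklore] -/
theorem FramedGaloisRep.exists_heckeCharacter_of_isDeRhamFramed_iff :
    FramedGaloisRep.exists_heckeCharacter_of_isDeRhamFramed ↔
      ∀ (K : Type) [Field K] [NumberField K] (ℓ : ℕ) [Fact ℓ.Prime]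
        (ψ : FramedGaloisRep K (PadicAlgCl ℓ) 1),
        (∀ (v : HeightOneSpectrum (𝓞 K)) (hv : ((ℓ : ℕ) : 𝓞 K) ∈ v.asIdeal),
          (PAdicHodge.fontainePstAdicCompletion v ℓ hv).IsDeRhamFramed (ψ.toLocal v)) →
        ∀ (ι : PadicAlgCl ℓ ≃+* ℂ), ∃ χ : HeckeCharacter K, χ.IsAlgebraic ∧
          ∀ᶠ v : HeightOneSpectrum (𝓞 K) in cofinite, χ.IsUnramifiedAt v ∧ ψ.IsUnramifiedAt v ∧
            ψ.HasFrobCharpolyAt v (X - C (ι.symm (χ.valueAtUniformizer v)⁻¹)) :=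
  Iff.rfl

/-- **Round trip with Weil's theorem** (sanity, granting both named facts): the `ℓ`-adic avatar `r` of
an algebraic Hecke character `χ` (de Rham above `ℓ` by `HeckeCharacter.exists_lAdic_isDeRhamFramed`)
comes from SOME algebraic Hecke character `χ'` with the same Frobenius dictionary almost everywhere
(by the present fact) — so the hypothesis class of the fact is inhabited by every `χ_{ℓ,ι}`.
[folklore] -/
theorem FramedGaloisRep.exists_heckeCharacter_of_lAdic
    (h₁ : HeckeCharacter.exists_lAdic_isDeRhamFramed)
    (h₂ : FramedGaloisRep.exists_heckeCharacter_of_isDeRhamFramed)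
    {K : Type} [Field K] [NumberField K] {ℓ : ℕ} [Fact ℓ.Prime] {χ : HeckeCharacter K}
    (hχ : χ.IsAlgebraic) (ι : PadicAlgCl ℓ ≃+* ℂ) :
    ∃ (r : FramedGaloisRep K (PadicAlgCl ℓ) 1) (χ' : HeckeCharacter K), χ'.IsAlgebraic ∧
      ∀ᶠ v : HeightOneSpectrum (𝓞 K) in cofinite, χ'.IsUnramifiedAt v ∧ r.IsUnramifiedAt v ∧
        r.HasFrobCharpolyAt v (X - C (ι.symm (χ'.valueAtUniformizer v)⁻¹)) := by
  obtain ⟨r, -, hr⟩ := h₁ K ℓ χ hχ ι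
  obtain ⟨χ', hχ', h'⟩ := h₂ K ℓ r hr ι
  exact ⟨r, χ', hχ', h'⟩

end Literature.NumberTheory.GaloisRepresentations

end
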